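import Summits.QuantumFields.YangMills.Theorems.BalabanUVNodesN22W1StripLastCoupling

/-!
# BalabanUVNodes ∕ node N22 = NE9 — THE STRIP INDUCTION AT THE W1 OBJECT, MODULE 14′: THE PRODUCER CHAIN IN THE FIXED-DOMAIN («On») CURRENCY —
# the repair of this seat's LOCATED-STRIP-DOMAIN: one open domain per (history, coupling), the OLDER-coupling level-T hypothesis UNIVERSAL IN THE DOMAIN,
# the last coupling on the `EHoloAt` domain, and the conversion back to module 1's ∃O-STRIP so that every landed consumer applies verbatim

Cell `pub-ymgap`, HUMAN RULING D-0062 (Track A), R134 ACCELERATION re-seat `pub-ymgap-dag-n22-c` (strategy s1), generation 4, module 14′.  THEOREMS ONLY; imports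
module 11 `…N22W1StripLastCoupling` (p478264; transitively modules 1 ∕ 3 ∕ 8, S25 `analytic_and_bounded_locE_param_torus`, the Lemma-3 socket
`B13Lemma3TorusSocket.h238_of_hRep_half` ∕ `hRep_of_termwise`, node00-def-W1 g3's `sfTowerOfRecord` and N09's `B12BetaHolo.EHoloAt`) BY NAME.  `--supports` K3′ (helper).

WHY (LOCATED-STRIP-DOMAIN, this seat's g4 self-audit of its own lineage; nothing landed is false).  Modules 3 ∕ 8 ∕ 11 ∕ 12 ∕ 13 display the OLDER-coupling level-T
hypothesis `h226T` ∕ `h226TOlder` in the ∃O currency of module 1's STRIP: its PREMISE hands the supplier every lower term `E^{(j)}(Y, ψ; g|g_i := ·)` holomorphic and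
(1.18)-bounded on ITS OWN open `O_{j,Y,ψ} ⊇` the closed `r`-discs about `]0, γ]`, and its CONCLUSION asks for ONE open `O ⊇` the same discs carrying the complexified
activities.  Print's supplier ([II] (2.14)–(2.26): the terms of `H^{(k)}(Z)` are fluctuation INTEGRALS over a continuum of configurations `ψ` of the old terms) can only
work on a domain inside `⋂_ψ O_{j,Y,ψ}`, whose interior need not contain the closed discs — the ∃O currency forgets the one datum the induction needs, a COMMON
domain.  THE REPAIR (R-a): the fixed-domain currency STRIP_D — `∃ Ec, DifferentiableOn ℂ Ec D ∧ (∀ z ∈ D, ‖Ec z‖ ≤ E₀e^{−κ d_j(Y)}) ∧ (trace on ]0, γ])` for ONE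
domain `D = D g i` per (history, coupling) — and the level-T hypothesis UNIVERSAL IN THE DOMAIN («for every open `D ⊇` the closed `r`-discs: lower terms holomorphic +
(1.18)-bounded ON `D` ⟹ complexified activities holomorphic + termwise-(2.26)-dominated ON `D`»), which IS what (2.14)–(2.26) give (operations on functions holomorphic
and bounded on a common `D` stay so; node00-def-W1 g4's schemas `StepGen.AnalyticInLast` ∕ `PropagatesAnalyticity` are fixed-domain for the same reason).  The S25 step
and Lemma 3's resummation on the strip were same-domain arguments already (modules 1 §2 ∕ 3 §1–§2 return the input `O`; only their STATEMENTS hide it behind `∃ O`) — §2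
re-states them with the domain kept.  The MIXED producer takes `D g i := (H g i).U`, the domain of node N09's `EHoloAt` datum for the new term of level `i + 1` in the
coupling `g_i`: the LAST-coupling STRIP lives there by `H.holo ∕ H.bound ∕ H.eq` (§3), and the OLDER supplier is asked on that same `D` — it is universal in `D`.

WHAT.
* §1 `stripBoundOn_termC_of_stepOutOn` — module 1's induction on the level in the fixed-domain currency with a domain family `D g i` containing the window points
  (level `0` no term; unread couplings `i ≥ j` by the constant extension of the real value read off `STRIP_D(j, 0)` at `g₀ ∈ D g 0`).
* §2 `stripOn_succ_of_complexifiedActivities` (S25 on a given open domain, the domain KEPT), `stripOn_succ_of_termwise226` (level T on a given open domain: print's term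
  set `terms L M Z`, (2.26)-weights `weight`, socket `hRep_of_termwise` + `h238_of_hRep_half`, then S25 — the domain KEPT).
* §3 `stripOn_last_of_eHoloAt` — the LAST-coupling STRIP_D at `D := H.U` from one `EHoloAt (sfTowerOfRecord Sg Rz M S ⟨g, β⟩ logZ) cs k` (`γ ≤ cs.γ`, `κ ≤ cs.κ`,
  `H.E₀ ≤ E₀`, `0 ≤ E₀`).
* §4 ★ `stripBound_termC_of_termwise226OnOlder_eHoloAt` — THE MIXED PRODUCER, REPAIRED: the OLDER-coupling level-T hypothesis UNIVERSAL IN THE DOMAIN (`h226TOnOlder`,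
  node N10's lane, displayed) + one `EHoloAt` per window history and step with `H.E₀ ≤ E₀`, `r ≤ H.r` (node N09's currency) + the socket numerals + S25 + renewal ⟹
  module 1's ∃O-STRIP at every level in every coupling at the space table of record — so modules 2 ∕ 5 ∕ 7 ∕ 9 ∕ 10 ∕ 12 (letters (A), NE9 by Cauchy, the N18 edge, the
  knits) apply VERBATIM.
* §5 `termwise226OnOlder_termlessTower` — NON-VACUITY (A5 rider): the termless model tower carries `h226TOnOlder` (`Hc ≡ 0`, `Tt ≡ 0`; model tower, NOT NODE 00's).

HONEST FRAMING.  Count-neutral by-name knit AT THE OBJECT; NOT a discharge of N22.  `h226TOnOlder` is DISPLAYED and asserted nowhere: it is [II] (2.14)–(2.26) per term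
with the old terms replaced by their holomorphic extensions on a common domain in ONE OLDER young coupling (`g_i`, `i < k`, read through the old terms only, (2.15)
p. 15) — NOT PRINTED as such; the term VALUES `Tt` are data of the hypothesis indexed by print's `terms L M Z`; the `EHoloAt` family is node N09's currency ([I] p. 263
«(or analytic)» in the LAST coupling, with (1.18) on a complex neighbourhood); every constant restriction is the socket's printed list (`Lemma3Numerics`) + S25's two
located clauses + the renewal `e·9·64·K₀(64,8)²·C₃ε₁ ≤ E₀`.  NE9 NOT IN PRINT, NOT PROVED; one finite four-torus programme at fixed ε — NOT infinite volume, NOT OS on ℝ⁴,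
NOT a mass gap, NOT Clay.  0 `sorry`, 0 `def`, standard axioms.

References (TYPES only): [I] = [Balaban1987RG1] (0.23)–(0.25) pp. 256–257, (1.18) p. 263, p. 266–267; [II] = [Balaban1988RG2Cluster] (2.9)–(2.15) pp. 14–15,
(2.26) p. 17, pp. 17–20 (resummation), Lemma 3 (2.38) p. 20, (2.39)–(2.41) p. 21.
-/

noncomputable section

namespace YMDAG.N22.W1

open Set Metric
open scoped BigOperators
open Literature.MathematicalPhysics.QuantumFieldTheory.Balaban1983to89
open Literature.MathematicalPhysics.QuantumFieldTheory.Balaban1983to89.T4Continuum (T4Family)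
open Literature.MathematicalPhysics.QuantumFieldTheory.Balaban1983to89.T4OutputRate
open Literature.MathematicalPhysics.QuantumFieldTheory.Balaban1983to89.B13Resummation (locE)
open Literature.MathematicalPhysics.QuantumFieldTheory.Balaban1983to89.TreeLengthTorus (TPt TDom tsys torusTreeLen torusTreeLen_nonneg)
open Literature.MathematicalPhysics.QuantumFieldTheory.Balaban1983to89.TreeLengthTorusGeometry (TTouch)
open Literature.MathematicalPhysics.QuantumFieldTheory.Balaban1983to89.B12TreeDecay (K₀ K₀_pos)
open Literature.MathematicalPhysics.QuantumFieldTheory.Balaban1983to89.B13Lemma3TorusData (TBond)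
open Literature.MathematicalPhysics.QuantumFieldTheory.Balaban1983to89.B13Lemma3Torus (TwoTorusStep)
open Literature.MathematicalPhysics.QuantumFieldTheory.Balaban1983to89.B13Lemma3TorusTerms (terms weight weight_nonneg)
open Literature.MathematicalPhysics.QuantumFieldTheory.Balaban1983to89.B13Lemma3TorusSocket (HRep Lemma3Numerics h238_of_hRep_half hRep_of_termwise)
open Literature.MathematicalPhysics.QuantumFieldTheory.Balaban1983to89.B12BetaHolo (EHoloAt)
open Literature.MathematicalPhysics.QuantumFieldTheory.Balaban1983to89.Step (SFConsts)
open Literature.MathematicalPhysics.QuantumFieldTheory.Balaban1983to89.Node00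
open Literature.MathematicalPhysics.QuantumFieldTheory.Balaban1983to89.Node00.Sect2 (domSys domCount CPair ofBackgroundC spaceI domSites Setting Residual)
open Literature.MathematicalPhysics.QuantumFieldTheory.Balaban1983to89.Node00.W1
open Summit.QuantumFields.BalabanUV.T4Continuum.NE1p.DressedOutputAnalyticFaces (analytic_and_bounded_locE_param_torus)

variable (F : T4Family) (K : ℕ) {𝔸 : Type*} {M : ℕ}

/-! ## §1 The induction on the level in the fixed-domain currency -/

/-- **THE INDUCTION ON THE LEVEL, FIXED-DOMAIN CURRENCY.**  For W1's tower `S`, a space table `sp`, the window `]0, γ]`, letters `E₀ ≥ 0`, `κ`, and a DOMAIN FAMILY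
`D g i ⊆ ℂ` (one domain per history and coupling) containing the window points: IF for every step `k`, window history `g`, coupling `i ≤ k`, `X ∈ 𝐃_{k+1}`,
`φ ∈ sp (k+1) X`, STRIP_D at all levels `j ≤ k` in coupling `i` ON `D g i` implies STRIP_D(k+1, i) ON THE SAME `D g i` — THEN STRIP_D(j, i) holds at every level in
every coupling: level `0` has no term ([I] (0.23)); a coupling `i ≥ j` is not read by the level-`j` term ([I] p. 256, `termC_congr_prefix`), whose real value — read off
`STRIP_D(j, 0)` at the window point `g₀ ∈ D g 0` — extends as a constant (holomorphic on any domain). [cite: Balaban1987RG1, (0.23) p.256 and (1.18) p.263; Balaban1988RG2Cluster, (2.40)-(2.41) p.21] -/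
theorem stripBoundOn_termC_of_stepOutOn {P : Params} (S : ClusterTower P 𝔸 M) (sp : (j : ℕ) → (domSys P M j).Dom → Set (CPair P 𝔸))
    (D : (ℕ → ℝ) → ℕ → Set ℂ) {γ E₀ κ : ℝ} (hE₀ : 0 ≤ E₀) (hD : ∀ g ∈ Window γ, ∀ (i : ℕ), ∀ t ∈ Ioc (0 : ℝ) γ, ((t : ℝ) : ℂ) ∈ D g i)
    (hstep : ∀ (k : ℕ) (g : ℕ → ℝ), g ∈ Window γ → ∀ (i : ℕ), i < k + 1 → ∀ (X : (domSys P M (k + 1)).Dom) (φ : CPair P 𝔸),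
      φ ∈ sp (k + 1) X →
      (∀ (j : ℕ), j < k + 1 → ∀ (Y : (domSys P M j).Dom) (ψ : CPair P 𝔸), ψ ∈ sp j Y →
        ∃ Ec : ℂ → ℂ, DifferentiableOn ℂ Ec (D g i) ∧ (∀ z ∈ D g i, ‖Ec z‖ ≤ E₀ * Real.exp (-(κ * torusTreeLen Y.1))) ∧
          (∀ t ∈ Ioc (0 : ℝ) γ, Ec t = termC S j Y (Function.update g i t) ψ)) →
      ∃ Ec : ℂ → ℂ, DifferentiableOn ℂ Ec (D g i) ∧ (∀ z ∈ D g i, ‖Ec z‖ ≤ E₀ * Real.exp (-(κ * torusTreeLen X.1))) ∧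
        (∀ t ∈ Ioc (0 : ℝ) γ, Ec t = termC S (k + 1) X (Function.update g i t) φ)) :
    ∀ (j : ℕ) (g : ℕ → ℝ), g ∈ Window γ → ∀ (i : ℕ) (Y : (domSys P M j).Dom) (ψ : CPair P 𝔸), ψ ∈ sp j Y →
      ∃ Ec : ℂ → ℂ, DifferentiableOn ℂ Ec (D g i) ∧ (∀ z ∈ D g i, ‖Ec z‖ ≤ E₀ * Real.exp (-(κ * torusTreeLen Y.1))) ∧
        (∀ t ∈ Ioc (0 : ℝ) γ, Ec t = termC S j Y (Function.update g i t) ψ) := by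
  -- strong induction on the level, packaged as `∀ n, ∀ j ≤ n, …`
  suffices h : ∀ (n j : ℕ), j ≤ n → ∀ (g : ℕ → ℝ), g ∈ Window γ → ∀ (i : ℕ) (Y : (domSys P M j).Dom) (ψ : CPair P 𝔸), ψ ∈ sp j Y →
      ∃ Ec : ℂ → ℂ, DifferentiableOn ℂ Ec (D g i) ∧ (∀ z ∈ D g i, ‖Ec z‖ ≤ E₀ * Real.exp (-(κ * torusTreeLen Y.1))) ∧
        (∀ t ∈ Ioc (0 : ℝ) γ, Ec t = termC S j Y (Function.update g i t) ψ) from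
    fun j => h j j le_rfl
  -- the constant extension of a value already bounded
  have hconst : ∀ (j : ℕ) (g : ℕ → ℝ) (i : ℕ) (Y : (domSys P M j).Dom) (ψ : CPair P 𝔸),
      ‖termC S j Y g ψ‖ ≤ E₀ * Real.exp (-(κ * torusTreeLen Y.1)) →
      (∀ t ∈ Ioc (0 : ℝ) γ, termC S j Y (Function.update g i t) ψ = termC S j Y g ψ) →
      ∃ Ec : ℂ → ℂ, DifferentiableOn ℂ Ec (D g i) ∧ (∀ z ∈ D g i, ‖Ec z‖ ≤ E₀ * Real.exp (-(κ * torusTreeLen Y.1))) ∧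
        (∀ t ∈ Ioc (0 : ℝ) γ, Ec t = termC S j Y (Function.update g i t) ψ) := by
    intro j g i Y ψ hb hupd
    exact ⟨fun _ => termC S j Y g ψ, differentiableOn_const _, fun z _ => hb, fun t ht => (hupd t ht).symm⟩
  intro n
  induction n with
  | zero =>
    intro j hj g _ i Y ψ _
    obtain rfl : j = 0 := Nat.le_zero.mp hj
    refine hconst 0 g i Y ψ ?_ fun t _ => ?_
    · rw [termC_zero, norm_zero]; positivity
    · rw [termC_zero, termC_zero]
  | succ n ih =>
    intro j hj g hg i Y ψ hψ
    rcases Nat.lt_succ_iff_lt_or_eq.mp (Nat.lt_succ_of_le hj) with hjn | rfl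
    · exact ih j (Nat.lt_succ_iff.mp hjn) g hg i Y ψ hψ
    · -- level `n + 1`: the couplings `i ≤ n` by the one-step hypothesis fed with the induction hypothesis
      have hlt : ∀ (i : ℕ), i < n + 1 →
          ∃ Ec : ℂ → ℂ, DifferentiableOn ℂ Ec (D g i) ∧ (∀ z ∈ D g i, ‖Ec z‖ ≤ E₀ * Real.exp (-(κ * torusTreeLen Y.1))) ∧
            (∀ t ∈ Ioc (0 : ℝ) γ, Ec t = termC S (n + 1) Y (Function.update g i t) ψ) := fun i hi =>
        hstep n g hg i hi Y ψ hψ fun j hj Y' ψ' hψ' => ih j (Nat.lt_succ_iff.mp hj) g hg i Y' ψ' hψ'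
      by_cases hi : i < n + 1
      · exact hlt i hi
      · -- a coupling `i ≥ n + 1` is not read at level `n + 1`: real bound off `STRIP_D(n+1, 0)` at the window point `g 0 ∈ D g 0`, constant extension
        obtain ⟨Ec, -, hB, hrep⟩ := hlt 0 (Nat.succ_pos n)
        have hg0 : g 0 ∈ Ioc (0 : ℝ) γ := hg 0
        have hmem : ((g 0 : ℝ) : ℂ) ∈ D g 0 := hD g hg 0 (g 0) hg0
        refine hconst (n + 1) g i Y ψ ?_ fun t _ => ?_
        · have h := hB _ hmem
          rwa [hrep (g 0) hg0, Function.update_eq_self] at h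
        · exact termC_congr_prefix S (n + 1) Y (g := Function.update g i t) (g' := g)
            (fun m hm => Function.update_of_ne (by omega) _ _) ψ

/-! ## §2 The same-domain one-point steps: S25, and Lemma 3's resummation on the strip (level T) -/

open Classical in
/-- **ONE STEP AT ONE POINT ON A GIVEN OPEN DOMAIN, ACTIVITY LEVEL — THE DOMAIN KEPT** (module 3 §1 re-stated): a complexified activity family `Hc`, holomorphic on
the open `O` polymer by polymer inside `X`, with `‖Hc z Z‖ ≤ A·e^{−R·d_{k+1}(Z)}` on `O` and `Hc t = (S k).H (g | g_i := t)|_{≤k} φ` at real `t ∈ ]0, γ]`, gives — under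
S25's located numerals and the renewal `e·9·64·K₀(64,8)²·A ≤ E₀` — a function `Ec` HOLOMORPHIC ON THE SAME `O` with `‖Ec z‖ ≤ E₀·e^{−κ d_{k+1}(X)}` on `O` and
`Ec t = E^{(k+1)}(X; g | g_i := t; φ)` on `]0, γ]` (S25 `analytic_and_bounded_locE_param_torus` BY NAME; (2.13) definitional in W1). [cite: Balaban1988RG2Cluster, (2.39)-(2.41) p.21; Balaban1987RG1, (1.18) p.263] -/
theorem stripOn_succ_of_complexifiedActivities (S : ClusterTower (F.P K) 𝔸 M) {γ E₀ κ A R r₁ : ℝ} (hA0 : 0 ≤ A) (hr₁ : 0 ≤ r₁) (hκ : κ ≤ r₁)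
    (hrate : r₁ + 2 * (64 * Real.log 162) + 2 ≤ R) (hsmall : A * Real.exp (5 * r₁ + 1) * K₀ 64 8 * 9 * 64 ≤ 1)
    (hrenew : Real.exp 1 * 9 * 64 * K₀ 64 8 ^ 2 * A ≤ E₀) (k : ℕ) (g : ℕ → ℝ) (i : ℕ) (X : (domSys (F.P K) M (k + 1)).Dom)
    (φ : CPair (F.P K) 𝔸) (Hc : ℂ → (domSys (F.P K) M (k + 1)).Dom → ℂ) (O : Set ℂ) (hO : IsOpen O)
    (hhol : ∀ Z : (domSys (F.P K) M (k + 1)).Dom, Z.1 ⊆ X.1 → DifferentiableOn ℂ (fun z => Hc z Z) O)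
    (hmaj : ∀ z ∈ O, ∀ Z : (domSys (F.P K) M (k + 1)).Dom, Z.1 ⊆ X.1 → ‖Hc z Z‖ ≤ A * Real.exp (-(R * torusTreeLen Z.1)))
    (hrepH : ∀ t ∈ Ioc (0 : ℝ) γ, Hc t = (S k).H (restrictPrefix k (Function.update g i t)) φ) :
    ∃ Ec : ℂ → ℂ, DifferentiableOn ℂ Ec O ∧ (∀ z ∈ O, ‖Ec z‖ ≤ E₀ * Real.exp (-(κ * torusTreeLen X.1))) ∧
      (∀ t ∈ Ioc (0 : ℝ) γ, Ec t = termC S (k + 1) X (Function.update g i t) φ) := by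
  have key := analytic_and_bounded_locE_param_torus (N := domCount (F.P K) M (k + 1)) (P := ℂ)
    (m := fun Z : (tsys 4 (domCount (F.P K) M (k + 1))).Dom => A * Real.exp (-(R * torusTreeLen Z.1)))
    (act := Hc) (A := A) (R := R) (r₁ := r₁) X hO hA0 hr₁ hrate hsmall hhol (fun z hz Z hZ => hmaj z hz Z hZ) (fun Z _ => le_rfl)
  have hM : 0 ≤ Real.exp 1 * 9 * 64 * K₀ 64 8 ^ 2 * A := by positivity
  refine ⟨fun z => locE (TTouch (d := 4) (N := domCount (F.P K) M (k + 1)))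
      (fun Z : (tsys 4 (domCount (F.P K) M (k + 1))).Dom => Z.1) (Hc z) X.1, key.1, fun z hz => ?_, fun t ht => ?_⟩
  · calc ‖locE (TTouch (d := 4) (N := domCount (F.P K) M (k + 1))) (fun Z : (tsys 4 (domCount (F.P K) M (k + 1))).Dom => Z.1)
            (Hc z) X.1‖
        ≤ Real.exp 1 * 9 * 64 * K₀ 64 8 ^ 2 * A * Real.exp (-(r₁ * torusTreeLen X.1)) := key.2 z hz
      _ ≤ E₀ * Real.exp (-(κ * torusTreeLen X.1)) :=
          mul_le_mul hrenew (Real.exp_le_exp.2 (neg_le_neg (mul_le_mul_of_nonneg_right hκ (torusTreeLen_nonneg _))))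
            (Real.exp_nonneg _) (le_trans hM hrenew)
  · exact (congrArg (fun w : TDom 4 (domCount (F.P K) M (k + 1)) → ℂ =>
      locE (TTouch (d := 4) (N := domCount (F.P K) M (k + 1)))
        (fun Z : (tsys 4 (domCount (F.P K) M (k + 1))).Dom => Z.1) w X.1) (hrepH t ht)).trans rfl

open Classical in
/-- **LEVEL T ON A GIVEN OPEN DOMAIN — THE DOMAIN KEPT: (2.26) FOR EVERY TERM (𝐃, P) ON THE DOMAIN ⟹ STRIP_O(k+1, i) at `(g, X, φ)`** (module 3 §2 re-stated).
Complexified term values `Tt Z t z` indexed by print's term set `terms L M Z` DOMINATING the complexified activity on `O`, `‖Hc z Z‖ ≤ Σ_{t ∈ terms L M Z} ‖Tt Z t z‖`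
(`z ∈ O`, `Z ⊆ X`), each obeying (2.26) p. 17 with the printed weight, `‖Tt Z t z‖ ≤ weight(t)·e^{a₅|Z|}`, the activity holomorphic on `O` and equal to
`(S k).H (g | g_i := t)|_{≤k} φ` at real `t`: the socket's `hRep_of_termwise` (the printed resummation ORDER p. 17) and `h238_of_hRep_half` (Lemma 3's resummation
pp. 17–20 at `ℓ = ½L`, `L ≥ 8`, numerics `Lemma3Numerics`) give (2.38) ON `O`, and the S25 step closes on the same `O` with `A := C₃ε₁`, `R := (1−8δ)½Lκ`.
[cite: Balaban1988RG2Cluster, (2.26) p.17 and Lemma 3 (2.38) p.20 (read on the strip)] -/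
theorem stripOn_succ_of_termwise226 [NeZero M] (S : ClusterTower (F.P K) 𝔸 M) (c : B13.Consts) {L : ℕ} [NeZero L] (hL : 8 ≤ c.L)
    (hLc : c.L = L) {a a₂ a₂' a₅ Aabs : ℝ} (hN : Lemma3Numerics c M ((c.L : ℝ) / 2) a a₂ a₂' a₅ Aabs)
    {γ E₀ κ r₁ : ℝ} (hA0 : 0 ≤ c.C3act * c.ε₁) (hr₁ : 0 ≤ r₁) (hκ : κ ≤ r₁)
    (hrate : r₁ + 2 * (64 * Real.log 162) + 2 ≤ (1 - 8 * c.δ) * ((c.L : ℝ) / 2) * c.κ)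
    (hsmall : c.C3act * c.ε₁ * Real.exp (5 * r₁ + 1) * K₀ 64 8 * 9 * 64 ≤ 1)
    (hrenew : Real.exp 1 * 9 * 64 * K₀ 64 8 ^ 2 * (c.C3act * c.ε₁) ≤ E₀) (k : ℕ) (g : ℕ → ℝ) (i : ℕ)
    (X : (domSys (F.P K) M (k + 1)).Dom) (φ : CPair (F.P K) 𝔸) (Hc : ℂ → TDom 4 (domCount (F.P K) M (k + 1)) → ℂ)
    (Tt : (Z : TDom 4 (domCount (F.P K) M (k + 1))) →
      Finset (TDom 4 (L * domCount (F.P K) M (k + 1))) × Finset (TBond 4 M (L * domCount (F.P K) M (k + 1))) → ℂ → ℂ)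
    (O : Set ℂ) (hO : IsOpen O)
    (hhol : ∀ Z : (domSys (F.P K) M (k + 1)).Dom, Z.1 ⊆ X.1 → DifferentiableOn ℂ (fun z => Hc z Z) O)
    (hdom : ∀ z ∈ O, ∀ Z : TDom 4 (domCount (F.P K) M (k + 1)), Z.1 ⊆ X.1 →
      ‖Hc z Z‖ ≤ ∑ t ∈ terms L M Z, ‖Tt Z t z‖)
    (h226 : ∀ z ∈ O, ∀ Z : TDom 4 (domCount (F.P K) M (k + 1)), Z.1 ⊆ X.1 → ∀ t ∈ terms L M Z,
      ‖Tt Z t z‖ ≤ weight L M c Z a t * Real.exp (a₅ * ((Z.1).card : ℝ)))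
    (hrepH : ∀ t ∈ Ioc (0 : ℝ) γ, Hc t = (S k).H (restrictPrefix k (Function.update g i t)) φ) :
    ∃ Ec : ℂ → ℂ, DifferentiableOn ℂ Ec O ∧ (∀ z ∈ O, ‖Ec z‖ ≤ E₀ * Real.exp (-(κ * torusTreeLen X.1))) ∧
      (∀ t ∈ Ioc (0 : ℝ) γ, Ec t = termC S (k + 1) X (Function.update g i t) φ) := by
  -- (2.26) per term in resummed-index form at the strip step on `O` (configuration type `ℂ`, space `{z ∈ O | Z ⊆ X}`)
  have hrep : HRep c M a a₅
      ({ volk := fun _ => 0, Φ := ℂ, Bond := PUnit, sp1 := fun _ => ∅, sp2 := fun Z => {z | z ∈ O ∧ Z.1 ⊆ X.1},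
         Bv := fun _ _ => 0, Vp := fun _ _ => 0, V := fun _ _ => 0, Q := fun _ _ _ _ => 0, Vpp := fun _ _ => 0,
         H := fun Z z => Hc z Z, Ek1 := fun _ _ => 0, Elog := fun _ _ => 0, Analytic := fun _ _ => True,
         GaugeInv := fun _ => True, Repr17 := True, Restr := True } : TwoTorusStep 4 L (domCount (F.P K) M (k + 1))) :=
    hRep_of_termwise c (mul_nonneg hN.hα₆.le hN.hε₀) _ (fun Z t z => Tt Z t z) (fun Z z hz => hdom z hz.1 Z hz.2)
      (fun Z z hz t ht => h226 z hz.1 Z hz.2 t ht)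
  -- Lemma 3 on the strip: (2.38) on `O`
  have h238 := h238_of_hRep_half c hL hLc (N' := fun _ : ℕ => domCount (F.P K) M (k + 1)) (fun _ => _) M hN
    (fun _ => hrep) 0
  exact stripOn_succ_of_complexifiedActivities F K S hA0 hr₁ hκ hrate hsmall hrenew k g i X φ Hc O hO hhol
    (fun z hz Z hZ => h238 Z z ⟨hz, hZ⟩) hrepH

/-! ## §3 The last coupling on the `EHoloAt` domain -/

section LastCoupling

variable [NormedRing 𝔸] [NormedAlgebra ℂ 𝔸] [CompleteSpace 𝔸] {G : Type*} [GaugeGroup G]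
  (Sg : Setting 𝔸 G) (Rz : Residual (F.P K) 𝔸) (logZ : ℕ → GaugeField (F.P K) 0 G → ℝ) (β : ℕ → ℝ → ℝ)

/-- **THE LAST-COUPLING STRIP ON THE `EHoloAt` DOMAIN**: one datum `H : EHoloAt (sfTowerOfRecord Sg Rz M S ⟨g, β⟩ logZ) cs k` (node N09's currency: the new term
`E^{(k+1)}` holomorphic in its last coupling `g_k` on the open `H.U ⊇` the closed `H.r`-discs about `[0, cs.γ]`, with (1.18) `H.E₀·e^{−cs.κ d}` there) gives, for
`γ ≤ cs.γ`, `κ ≤ cs.κ`, `H.E₀ ≤ E₀`, `0 ≤ E₀` and every `X ∈ 𝐃_{k+1}`, `φ ∈ U^c_{k+1}(X, cs.α₀, cs.α₁)`: STRIP_D(k+1, k) at `(g, X, φ)` ON `D := H.U` — `Ec := H.Ec X φ`.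
[cite: Balaban1987RG1, p.263 (clause before (1.18)) with pp.266-267] -/
theorem stripOn_last_of_eHoloAt (S : ClusterTower (F.P K) 𝔸 M) {cs : SFConsts} {γ E₀ κ : ℝ} (hγ : γ ≤ cs.γ) (hκ : κ ≤ cs.κ) (hE₀ : 0 ≤ E₀)
    {k : ℕ} {g : ℕ → ℝ} (H : EHoloAt (sfTowerOfRecord Sg Rz M S ⟨g, β⟩ logZ) cs k) (hHE : H.E₀ ≤ E₀) (X : (domSys (F.P K) M (k + 1)).Dom)
    (φ : CPair (F.P K) 𝔸) (hφ : φ ∈ spaceI Sg Rz M (k + 1) (domSites (F.P K) M (k + 1) X) cs.α₀ cs.α₁) :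
    ∃ Ec : ℂ → ℂ, DifferentiableOn ℂ Ec H.U ∧ (∀ z ∈ H.U, ‖Ec z‖ ≤ E₀ * Real.exp (-(κ * torusTreeLen X.1))) ∧
      (∀ t ∈ Ioc (0 : ℝ) γ, Ec t = termC S (k + 1) X (Function.update g k t) φ) := by
  have hI : ∀ t ∈ Ioc (0 : ℝ) γ, t ∈ Icc (0 : ℝ) cs.γ := fun t ht => ⟨ht.1.le, ht.2.trans hγ⟩
  -- the datum's cross-tower fields, routed through their tower-free forms (the `sfTowerOfRecord` faces are `rfl`)
  have hholo : ∀ (X : (domSys (F.P K) M (k + 1)).Dom) (φ : CPair (F.P K) 𝔸), φ ∈ spaceI Sg Rz M (k + 1) (domSites (F.P K) M (k + 1) X) cs.α₀ cs.α₁ →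
      DifferentiableOn ℂ (H.Ec X φ) H.U := H.holo
  have hbound : ∀ (X : (domSys (F.P K) M (k + 1)).Dom) (φ : CPair (F.P K) 𝔸), φ ∈ spaceI Sg Rz M (k + 1) (domSites (F.P K) M (k + 1) X) cs.α₀ cs.α₁ →
      ∀ z ∈ H.U, ‖H.Ec X φ z‖ ≤ H.E₀ * Real.exp (-cs.κ * torusTreeLen (Subtype.val X : Finset (TPt (F.P K).d (domCount (F.P K) M (k + 1))))) :=
    H.bound
  refine ⟨H.Ec X φ, hholo X φ hφ, fun z hz => ?_, fun t ht => (termC_update_eq_of_eHoloAt Sg Rz M S ⟨g, β⟩ logZ H X φ hφ (hI t ht)).symm⟩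
  have hb := hbound X φ hφ z hz
  rw [neg_mul] at hb
  calc ‖H.Ec X φ z‖ ≤ H.E₀ * Real.exp (-(cs.κ * torusTreeLen X.1)) := hb
    _ ≤ E₀ * Real.exp (-(cs.κ * torusTreeLen X.1)) := mul_le_mul_of_nonneg_right hHE (Real.exp_pos _).le
    _ ≤ E₀ * Real.exp (-(κ * torusTreeLen X.1)) :=
        mul_le_mul_of_nonneg_left (Real.exp_le_exp.2 (neg_le_neg (mul_le_mul_of_nonneg_right hκ (torusTreeLen_nonneg _)))) hE₀

/-! ## §4 THE MIXED PRODUCER, REPAIRED: older couplings by the level-T hypothesis UNIVERSAL IN THE DOMAIN, the last coupling by `EHoloAt` -/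

open Classical in
/-- **STRIP AT EVERY LEVEL IN EVERY COUPLING, AT THE SPACES OF RECORD, FROM THE OLDER-COUPLING LEVEL-T HYPOTHESIS UNIVERSAL IN THE DOMAIN + AN `EHoloAt` FAMILY.**
`h226TOnOlder` (node N10's lane, DISPLAYED, asserted nowhere): FOR EVERY OPEN `D ⊇` the closed `r`-discs about `]0, γ]`, every step `k`, window history `g`, OLDER
coupling `i < k`, `X ∈ 𝐃_{k+1}`, `φ ∈ U^c_{k+1}(X)`: the lower terms `E^{(j)}(Y, ψ; g|g_i := ·)` (`j ≤ k`, `ψ ∈ U^c_j(Y)`) holomorphic and (1.18)-bounded ON `D` ⟹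
complexified activities `Hc` holomorphic ON `D`, dominated ON `D` by complexified term values `Tt` over print's `terms L M Z` obeying (2.26) per term, with
`Hc t = (S k).H (g|g_i := t)|_{≤k} φ` on `]0, γ]` — [II] (2.14)–(2.26) READ ON A COMMON COMPLEX DOMAIN of one older coupling.  With one
`EHoloAt (sfTowerOfRecord Sg Rz M S ⟨g, β⟩ logZ) cs k` per window history and step (`H.E₀ ≤ E₀`, `r ≤ H.r`; node N09's currency; `γ ≤ cs.γ`, `κ ≤ cs.κ`), the socket
numerals `Lemma3Numerics c M (½L) …`, `8 ≤ c.L`, S25's clauses at `A := C₃ε₁`, `R := (1−8δ)½Lκ`, `κ ≤ r₁` and the renewal `e·9·64·K₀(64,8)²·C₃ε₁ ≤ E₀`: module 1's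
∃O-STRIP at EVERY level in EVERY coupling at the space table of record (the domain exhibited is `(H g i).U` for the coupling `g_i`).  Proof: §1 with `D g i := (H g i).U`,
the step by cases — `i < k` by `h226TOnOlder` at that domain and §2, `i = k` by §3. [cite: Balaban1988RG2Cluster, (2.14)-(2.26) pp.15-17 and Lemma 3 p.20 (read on the strip); Balaban1987RG1, (1.18) p.263 and pp.266-267] -/
theorem stripBound_termC_of_termwise226OnOlder_eHoloAt [NeZero M] (S : ClusterTower (F.P K) 𝔸 M) (c : B13.Consts) {L : ℕ} [NeZero L]
    (hL : 8 ≤ c.L) (hLc : c.L = L) {a a₂ a₂' a₅ Aabs : ℝ} (hN : Lemma3Numerics c M ((c.L : ℝ) / 2) a a₂ a₂' a₅ Aabs)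
    {cs : SFConsts} {γ r E₀ κ r₁ : ℝ} (hr : 0 ≤ r) (hA0 : 0 ≤ c.C3act * c.ε₁) (hr₁ : 0 ≤ r₁) (hκ : κ ≤ r₁)
    (hrate : r₁ + 2 * (64 * Real.log 162) + 2 ≤ (1 - 8 * c.δ) * ((c.L : ℝ) / 2) * c.κ)
    (hsmall : c.C3act * c.ε₁ * Real.exp (5 * r₁ + 1) * K₀ 64 8 * 9 * 64 ≤ 1)
    (hrenew : Real.exp 1 * 9 * 64 * K₀ 64 8 ^ 2 * (c.C3act * c.ε₁) ≤ E₀) (hγ : γ ≤ cs.γ) (hκc : κ ≤ cs.κ)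
    (h226TOnOlder : ∀ (D : Set ℂ), IsOpen D → (∀ t ∈ Ioc (0 : ℝ) γ, closedBall (t : ℂ) r ⊆ D) →
      ∀ (k : ℕ) (g : ℕ → ℝ), g ∈ Window γ → ∀ (i : ℕ), i < k → ∀ (X : (domSys (F.P K) M (k + 1)).Dom) (φ : CPair (F.P K) 𝔸),
      φ ∈ spaceI Sg Rz M (k + 1) (domSites (F.P K) M (k + 1) X) cs.α₀ cs.α₁ →
      (∀ (j : ℕ), j < k + 1 → ∀ (Y : (domSys (F.P K) M j).Dom) (ψ : CPair (F.P K) 𝔸), ψ ∈ spaceI Sg Rz M j (domSites (F.P K) M j Y) cs.α₀ cs.α₁ →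
        ∃ Ec : ℂ → ℂ, DifferentiableOn ℂ Ec D ∧ (∀ z ∈ D, ‖Ec z‖ ≤ E₀ * Real.exp (-(κ * torusTreeLen Y.1))) ∧
          (∀ t ∈ Ioc (0 : ℝ) γ, Ec t = termC S j Y (Function.update g i t) ψ)) →
      ∃ (Hc : ℂ → TDom 4 (domCount (F.P K) M (k + 1)) → ℂ)
        (Tt : (Z : TDom 4 (domCount (F.P K) M (k + 1))) →
          Finset (TDom 4 (L * domCount (F.P K) M (k + 1))) × Finset (TBond 4 M (L * domCount (F.P K) M (k + 1))) → ℂ → ℂ),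
        (∀ Z : (domSys (F.P K) M (k + 1)).Dom, Z.1 ⊆ X.1 → DifferentiableOn ℂ (fun z => Hc z Z) D) ∧
        (∀ z ∈ D, ∀ Z : TDom 4 (domCount (F.P K) M (k + 1)), Z.1 ⊆ X.1 → ‖Hc z Z‖ ≤ ∑ t ∈ terms L M Z, ‖Tt Z t z‖) ∧
        (∀ z ∈ D, ∀ Z : TDom 4 (domCount (F.P K) M (k + 1)), Z.1 ⊆ X.1 → ∀ t ∈ terms L M Z,
          ‖Tt Z t z‖ ≤ weight L M c Z a t * Real.exp (a₅ * ((Z.1).card : ℝ))) ∧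
        (∀ t ∈ Ioc (0 : ℝ) γ, Hc t = (S k).H (restrictPrefix k (Function.update g i t)) φ))
    (hE : ∀ g ∈ Window γ, ∀ k : ℕ, ∃ H : EHoloAt (sfTowerOfRecord Sg Rz M S ⟨g, β⟩ logZ) cs k, H.E₀ ≤ E₀ ∧ r ≤ H.r) :
    ∀ (j : ℕ) (g : ℕ → ℝ), g ∈ Window γ → ∀ (i : ℕ) (Y : (domSys (F.P K) M j).Dom) (ψ : CPair (F.P K) 𝔸),
      ψ ∈ spaceI Sg Rz M j (domSites (F.P K) M j Y) cs.α₀ cs.α₁ →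
      ∃ (Ec : ℂ → ℂ) (O : Set ℂ), IsOpen O ∧ (∀ t ∈ Ioc (0 : ℝ) γ, closedBall (t : ℂ) r ⊆ O) ∧ DifferentiableOn ℂ Ec O ∧
        (∀ z ∈ O, ‖Ec z‖ ≤ E₀ * Real.exp (-(κ * torusTreeLen Y.1))) ∧
        (∀ t ∈ Ioc (0 : ℝ) γ, Ec t = termC S j Y (Function.update g i t) ψ) := by
  have hM : 0 ≤ Real.exp 1 * 9 * 64 * K₀ 64 8 ^ 2 * (c.C3act * c.ε₁) := by positivity
  have hE₀ : 0 ≤ E₀ := le_trans hM hrenew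
  have hI : ∀ t ∈ Ioc (0 : ℝ) γ, t ∈ Icc (0 : ℝ) cs.γ := fun t ht => ⟨ht.1.le, ht.2.trans hγ⟩
  -- node N09's data, chosen once per (history, step)
  choose H hH using hE
  -- the domain family: the `EHoloAt` domain of the new term of level `i + 1` in the coupling `g_i` (anything off the window, never read)
  obtain ⟨D, hDg⟩ : ∃ D : (ℕ → ℝ) → ℕ → Set ℂ, ∀ (g : ℕ → ℝ) (hg : g ∈ Window γ) (i : ℕ), D g i = (H g hg i).U :=
    ⟨fun g i => if hg : g ∈ Window γ then (H g hg i).U else Set.univ, fun g hg i => dif_pos hg⟩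
  have hDopen : ∀ (g : ℕ → ℝ), g ∈ Window γ → ∀ i : ℕ, IsOpen (D g i) := fun g hg i => by
    rw [hDg g hg i]
    exact (H g hg i).isOpen
  have hDdisc : ∀ (g : ℕ → ℝ), g ∈ Window γ → ∀ (i : ℕ), ∀ t ∈ Ioc (0 : ℝ) γ, closedBall (t : ℂ) r ⊆ D g i := fun g hg i t ht => by
    rw [hDg g hg i]
    exact (closedBall_subset_closedBall (hH g hg i).2).trans ((H g hg i).ball_subset t (hI t ht))
  have hD : ∀ g ∈ Window γ, ∀ (i : ℕ), ∀ t ∈ Ioc (0 : ℝ) γ, ((t : ℝ) : ℂ) ∈ D g i := fun g hg i t ht =>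
    hDdisc g hg i t ht (mem_closedBall_self hr)
  -- §1's induction on the domain family; the step by cases on the coupling
  have hall := stripBoundOn_termC_of_stepOutOn S (fun j Y => spaceI Sg Rz M j (domSites (F.P K) M j Y) cs.α₀ cs.α₁) D hE₀ hD (by
    intro k g hg i hi X φ hφ hprem
    rcases Nat.lt_succ_iff_lt_or_eq.mp hi with hik | hik
    · -- an OLDER coupling: the level-T hypothesis at the domain `D g i`, then §2
      obtain ⟨Hc, Tt, hhol, hdom, h226, hrepH⟩ := h226TOnOlder (D g i) (hDopen g hg i) (hDdisc g hg i) k g hg i hik X φ hφ hprem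
      exact stripOn_succ_of_termwise226 F K S c hL hLc hN hA0 hr₁ hκ hrate hsmall hrenew k g i X φ Hc Tt (D g i) (hDopen g hg i) hhol hdom
        h226 hrepH
    · -- the LAST coupling: node N09's datum on its own domain (§3)
      subst hik
      rw [hDg g hg i]
      exact stripOn_last_of_eHoloAt F K Sg Rz logZ β S hγ hκc hE₀ (H g hg i) (hH g hg i).1 X φ hφ)
  intro j g hg i Y ψ hψ
  obtain ⟨Ec, hhol, hbd, htr⟩ := hall j g hg i Y ψ hψ
  exact ⟨Ec, D g i, hDopen g hg i, hDdisc g hg i, hhol, hbd, htr⟩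

end LastCoupling

/-! ## §5 Non-vacuity of the repaired hypothesis (A5 rider) -/

open Classical in
/-- **NON-VACUITY OF `h226TOnOlder` (A5 rider).**  The termless model tower (`idx Z = ∅`, `H ≡ 0`) carries the older-coupling level-T hypothesis UNIVERSAL IN THE DOMAIN
with `Hc ≡ 0`, `Tt ≡ 0` on every domain (domination `0 ≤ Σ 0`; (2.26) per term `0 ≤ weight·e^{a₅|Z|}` by `weight_nonneg`, `0 ≤ α₆ε₂`), whatever the antecedent — so §4 is
not a vacuous implication.  Model tower, NOT NODE 00's (junk-shaped per ref-H WATCH-W1-DEGENERATE, labelled so). [folklore] -/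
theorem termwise226OnOlder_termlessTower [NeZero M] {P : Params} (sp : (j : ℕ) → (domSys P M j).Dom → Set (CPair P 𝔸)) (c : B13.Consts)
    {L : ℕ} [NeZero L] (hA : 0 ≤ c.α₆ * c.eps2) {γ r E₀ κ a a₅ : ℝ} :
    ∀ (D : Set ℂ), IsOpen D → (∀ t ∈ Ioc (0 : ℝ) γ, closedBall (t : ℂ) r ⊆ D) →
      ∀ (k : ℕ) (g : ℕ → ℝ), g ∈ Window γ → ∀ (i : ℕ), i < k → ∀ (X : (domSys P M (k + 1)).Dom) (φ : CPair P 𝔸), φ ∈ sp (k + 1) X →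
      (∀ (j : ℕ), j < k + 1 → ∀ (Y : (domSys P M j).Dom) (ψ : CPair P 𝔸), ψ ∈ sp j Y →
        ∃ Ec : ℂ → ℂ, DifferentiableOn ℂ Ec D ∧ (∀ z ∈ D, ‖Ec z‖ ≤ E₀ * Real.exp (-(κ * torusTreeLen Y.1))) ∧
          (∀ t ∈ Ioc (0 : ℝ) γ, Ec t =
            termC (fun k => (⟨PUnit, fun _ => ∅, fun _ _ _ => 0⟩ : ClusterStep P 𝔸 M k)) j Y (Function.update g i t) ψ)) →
      ∃ (Hc : ℂ → TDom P.d (domCount P M (k + 1)) → ℂ)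
        (Tt : (Z : TDom P.d (domCount P M (k + 1))) →
          Finset (TDom P.d (L * domCount P M (k + 1))) × Finset (TBond P.d M (L * domCount P M (k + 1))) → ℂ → ℂ),
        (∀ Z : (domSys P M (k + 1)).Dom, Z.1 ⊆ X.1 → DifferentiableOn ℂ (fun z => Hc z Z) D) ∧
        (∀ z ∈ D, ∀ Z : TDom P.d (domCount P M (k + 1)), Z.1 ⊆ X.1 → ‖Hc z Z‖ ≤ ∑ t ∈ terms L M Z, ‖Tt Z t z‖) ∧
        (∀ z ∈ D, ∀ Z : TDom P.d (domCount P M (k + 1)), Z.1 ⊆ X.1 → ∀ t ∈ terms L M Z,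
          ‖Tt Z t z‖ ≤ weight L M c Z a t * Real.exp (a₅ * ((Z.1).card : ℝ))) ∧
        (∀ t ∈ Ioc (0 : ℝ) γ, Hc t =
          ((fun k => (⟨PUnit, fun _ => ∅, fun _ _ _ => 0⟩ : ClusterStep P 𝔸 M k)) k).H (restrictPrefix k (Function.update g i t)) φ) := by
  intro D _ _ k g _ i _ X φ _ _
  refine ⟨fun _ _ => 0, fun _ _ _ => 0, fun Z _ => differentiableOn_const 0, fun z _ Z _ => ?_, fun z _ Z _ t _ => ?_, fun t _ => ?_⟩
  · simp only [norm_zero, Finset.sum_const_zero, le_refl]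
  · rw [norm_zero]
    exact mul_nonneg (weight_nonneg (L := L) (M := M) c Z a hA t) (Real.exp_nonneg _)
  · funext Z
    simp [ClusterStep.H]

end YMDAG.N22.W1

end
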